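import Literature.Topology.FourManifolds.ComplexProjectiveSpace
import Mathlib.Topology.ContinuousMap.Basic

/-!
# Glued maps `ℂℙ¹ → X` of continuous two-chart pairs: existence, range, uniqueness
(registered helpers `helper_gluedExists`, `helper_gluedRange`, `helper_gluedUnique` of line
`cross-cap-laurent`, crux `GromovRecognitionRelEnd`, item stmt-SmoothPoincare4-11009)

Throughout the crux a (`J`-holomorphic) sphere in a space `X` is given in *two-chart form*: a pair
`u v : ℂ → X` with `v z = u z⁻¹` for `z ≠ 0`.  Its *glued map* is a continuous map
`F : C(ℂℙ¹, X)` on the tree's complex projective line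
`Literature.Topology.FourManifolds.ComplexProjectiveSpace 1` characterised by
`F [w₀ : w₁] = u (w₁ / w₀)` on the affine chart `{w₀ ≠ 0}` (`CoordNeZero 0`, complex coordinate
`affineCoordComplex 0 p 0 = w₁ / w₀`) and `F [w₀ : w₁] = v (w₀ / w₁)` on the chart `{w₁ ≠ 0}`
(`CoordNeZero 1`, coordinate `affineCoordComplex 1 p 0 = w₀ / w₁`).  This file proves the three
point-set facts the lead's skeleton uses about glued maps:

* `helper_gluedExists`: a continuous compatible pair has a glued map.  Define
  `F [w₀ : w₁] := u (w₁ / w₀)` if `w₀ ≠ 0` and `:= v (w₀ / w₁)` otherwise; on the chart `{w₁ ≠ 0}`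
  the compatibility `v z = u z⁻¹` shows `F = v ∘ (w₀ / w₁)` there too, so `F` is continuous on
  each of the two open affine charts (the complex affine coordinate is continuous on its chart:
  it is the chart `affineChart i` read back through `realCoordinates`), which cover `ℂℙ¹`
  (`exists_coordNeZero`).
* `helper_gluedRange`: `range F = range u ∪ {v 0}`: a point `[w₀ : w₁]` with `w₀ ≠ 0` is sent to
  `u (w₁ / w₀)`, and the only other point `[0 : 1]` is sent to `v 0`; conversely
  `u z = F [1 : z]` and `v 0 = F [0 : 1]`.
* `helper_gluedUnique`: two glued maps of the same pair agree (the two charts cover `ℂℙ¹`).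

References: P. Griffiths, J. Harris, *Principles of Algebraic Geometry* (1978), Ch. 0 §2 (affine
charts of `ℙⁿ`); D. McDuff, D. Salamon, *J-holomorphic Curves and Symplectic Topology*, 2nd ed.
(2012), §4.2 (spheres as maps of `S² = ℂ ∪ {∞}` through the two charts `z`, `1/z`).
-/

noncomputable section

-- the prescribed namespace `Summit.<P>.<Sub>.…` duplicates `SmoothPoincare4` (P = Sub)
set_option linter.dupNamespace false

open scoped Topology
open Set Function
open Literature.Topology.FourManifolds Literature.Topology.FourManifolds.ComplexProjectiveSpace

namespace Summit.SmoothPoincare4.SmoothPoincare4.Theorems.GromovRecognitionRelEnd.CrossCapLaurent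

namespace GluedBasics

/-! ### Elementary lemmas on the two affine charts of `ℂℙ¹` -/

/-- The complex affine coordinate `affineCoordComplex i` of `ℂℙⁿ` is continuous on the source
`{[w] | wᵢ ≠ 0}` of the `i`-th affine chart: there it is the (continuous) chart `affineChart i`
read back through the real-linear identification `realCoordinates n` (Griffiths–Harris, Ch. 0 §2).
[folklore] -/
theorem continuousOn_affineCoordComplex {n : ℕ} (i : Fin (n + 1)) :
    ContinuousOn (affineCoordComplex (n := n) i) {p | CoordNeZero i p} := by
  have h : affineCoordComplex (n := n) i = (realCoordinates n).symm ∘ affineChart i := by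
    funext p
    simp [affineChart_apply, affineCoord]
  rw [h]
  exact (realCoordinates n).symm.continuous.comp_continuousOn (affineChart i).continuousOn

/-- A map `F : ℂℙ¹ → X` that agrees on the `i`-th affine chart with `u ∘ cᵢ`, `cᵢ p =
affineCoordComplex i p 0` the complex affine coordinate and `u : ℂ → X` continuous, is continuous
on that chart. [folklore] -/
theorem continuousOn_of_eq_comp_affineCoordComplex {X : Type*} [TopologicalSpace X] {u : ℂ → X}
    {F : ComplexProjectiveSpace 1 → X} (i : Fin (1 + 1)) (hu : Continuous u)
    (hF : ∀ p, CoordNeZero i p → F p = u (affineCoordComplex i p 0)) :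
    ContinuousOn F {p | CoordNeZero i p} :=
  (hu.comp_continuousOn
    ((continuous_apply 0).comp_continuousOn (continuousOn_affineCoordComplex i))).congr
    fun p hp => hF p hp

/-- A map `F : ℂℙ¹ → X` that is `u ∘ c₀` on the chart `{w₀ ≠ 0}` and `v ∘ c₁` on the chart
`{w₁ ≠ 0}`, with `u v : ℂ → X` continuous, is continuous: the two open charts cover `ℂℙ¹`
(`exists_coordNeZero`). [folklore] -/
theorem continuous_of_eq_comp_affineCoordComplex {X : Type*} [TopologicalSpace X] {u v : ℂ → X}
    {F : ComplexProjectiveSpace 1 → X} (hu : Continuous u) (hv : Continuous v)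
    (h0 : ∀ p, CoordNeZero 0 p → F p = u (affineCoordComplex 0 p 0))
    (h1 : ∀ p, CoordNeZero 1 p → F p = v (affineCoordComplex 1 p 0)) : Continuous F := by
  refine continuous_iff_continuousAt.2 fun p => ?_
  rcases Fin.exists_fin_two.1 (exists_coordNeZero p) with hp | hp
  · exact (continuousOn_of_eq_comp_affineCoordComplex 0 hu h0).continuousAt
      ((isOpen_setOf_coordNeZero 0).mem_nhds hp)
  · exact (continuousOn_of_eq_comp_affineCoordComplex 1 hv h1).continuousAt
      ((isOpen_setOf_coordNeZero 1).mem_nhds hp)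

/-- The chart-`0` complex coordinate of `[w₀ : w₁] ∈ ℂℙ¹` is `w₁ / w₀`. [folklore] -/
theorem affineCoordComplex_zero_mk (w : {w : Fin (1 + 1) → ℂ // w ≠ 0}) :
    affineCoordComplex 0 (mk w) 0 = (w : Fin (1 + 1) → ℂ) 1 / (w : Fin (1 + 1) → ℂ) 0 := by
  have e0 : (0 : Fin 2).succAbove (0 : Fin 1) = 1 := by decide
  simp only [affineCoordComplex_mk, e0]

/-- The chart-`1` complex coordinate of `[w₀ : w₁] ∈ ℂℙ¹` is `w₀ / w₁`. [folklore] -/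
theorem affineCoordComplex_one_mk (w : {w : Fin (1 + 1) → ℂ // w ≠ 0}) :
    affineCoordComplex 1 (mk w) 0 = (w : Fin (1 + 1) → ℂ) 0 / (w : Fin (1 + 1) → ℂ) 1 := by
  have e1 : (1 : Fin 2).succAbove (0 : Fin 1) = 0 := by decide
  simp only [affineCoordComplex_mk, e1]

/-- The point `mk (homogenize i c)` of `ℂℙⁿ` (homogeneous coordinate `1` in slot `i`, the entries
of `c` elsewhere) lies in the `i`-th affine chart. [folklore] -/
theorem coordNeZero_mk_homogenize {n : ℕ} (i : Fin (n + 1)) (c : Fin n → ℂ) :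
    CoordNeZero i (mk (homogenize i c)) := by
  simp [homogenize]

/-- The `i`-th complex affine coordinates of `mk (homogenize i c)` are `c` (homogenisation is the
inverse of the affine chart). [folklore] -/
theorem affineCoordComplex_mk_homogenize {n : ℕ} (i : Fin (n + 1)) (c : Fin n → ℂ) :
    affineCoordComplex i (mk (homogenize i c)) = c := by
  funext j
  simp [homogenize]

/-- A nonzero vector of `ℂ²` with vanishing `0`-th coordinate has nonvanishing `1`-st
coordinate. [folklore] -/
theorem apply_one_ne_zero (w : {w : Fin (1 + 1) → ℂ // w ≠ 0}) (h0 : (w : Fin (1 + 1) → ℂ) 0 = 0) :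
    (w : Fin (1 + 1) → ℂ) 1 ≠ 0 := by
  intro h1
  apply w.2
  funext j
  rcases Fin.exists_fin_two.1 ⟨j, rfl⟩ with rfl | rfl
  · exact h0
  · exact h1

/-! ### Values of a glued map -/

section Values

variable {X : Type*} {u v : ℂ → X} {F : ComplexProjectiveSpace 1 → X}

/-- A glued map takes the value `u z` at `[1 : z]`. [folklore] -/
theorem glued_apply_pt_zero (h0 : ∀ p, CoordNeZero 0 p → F p = u (affineCoordComplex 0 p 0))
    (z : ℂ) : F (mk (homogenize 0 fun _ : Fin 1 => z)) = u z := by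
  rw [h0 _ (coordNeZero_mk_homogenize 0 _), affineCoordComplex_mk_homogenize]

/-- A glued map takes the value `v 0` at `[0 : 1]`. [folklore] -/
theorem glued_apply_pt_infty (h1 : ∀ p, CoordNeZero 1 p → F p = v (affineCoordComplex 1 p 0)) :
    F (mk (homogenize 1 fun _ : Fin 1 => 0)) = v 0 := by
  rw [h1 _ (coordNeZero_mk_homogenize 1 _), affineCoordComplex_mk_homogenize]

/-- Off the chart `{w₀ ≠ 0}` a glued map takes the single value `v 0` (the only such point is
`[0 : 1]`). [folklore] -/
theorem glued_apply_of_not_coordNeZero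
    (h1 : ∀ p, CoordNeZero 1 p → F p = v (affineCoordComplex 1 p 0))
    {p : ComplexProjectiveSpace 1} (hp : ¬ CoordNeZero 0 p) : F p = v 0 := by
  induction p using ComplexProjectiveSpace.ind with
  | h w =>
    have hw0 : (w : Fin (1 + 1) → ℂ) 0 = 0 := by simpa using hp
    have hw1 : (w : Fin (1 + 1) → ℂ) 1 ≠ 0 := apply_one_ne_zero w hw0
    rw [h1 _ ((coordNeZero_mk 1 w).2 hw1), affineCoordComplex_one_mk, hw0, zero_div]

end Values

end GluedBasics

open GluedBasics

/-- **Existence of the glued map** (registered stub `helper_gluedExists` of line `cross-cap-laurent`,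
signature verbatim).  A continuous two-chart pair `u v : ℂ → X` with `v z = u z⁻¹` for `z ≠ 0`
glues to a continuous map `F : ℂℙ¹ → X` with `F [w₀ : w₁] = u (w₁ / w₀)` on `{w₀ ≠ 0}` and
`F [w₀ : w₁] = v (w₀ / w₁)` on `{w₁ ≠ 0}`: set `F [w₀ : w₁] := u (w₁ / w₀)` if `w₀ ≠ 0` and
`:= v (w₀ / w₁)` otherwise; on the overlap the two recipes agree by the compatibility, and `F` is
continuous on each of the two open affine charts, which cover `ℂℙ¹` (McDuff–Salamon 2012, §4.2;
Griffiths–Harris, Ch. 0 §2). [folklore] -/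
theorem helper_gluedExists : ∀ (X : Type) [TopologicalSpace X] (u v : ℂ → X), Continuous u → Continuous v → (∀ z : ℂ, z ≠ 0 → v z = u z⁻¹) → ∃ F : C(ComplexProjectiveSpace 1, X), (∀ p, CoordNeZero 0 p → F p = u (affineCoordComplex 0 p 0)) ∧ (∀ p, CoordNeZero 1 p → F p = v (affineCoordComplex 1 p 0)) := by
  intro X _ u v hu hv huv
  classical
  -- the glued function
  set F : ComplexProjectiveSpace 1 → X := fun p =>
    if CoordNeZero 0 p then u (affineCoordComplex 0 p 0) else v (affineCoordComplex 1 p 0)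
  have h0 : ∀ p, CoordNeZero 0 p → F p = u (affineCoordComplex 0 p 0) := fun p hp => if_pos hp
  have h1 : ∀ p, CoordNeZero 1 p → F p = v (affineCoordComplex 1 p 0) := by
    intro p hp
    by_cases hp0 : CoordNeZero 0 p
    · rw [h0 p hp0]
      induction p using ComplexProjectiveSpace.ind with
      | h w =>
        simp only [coordNeZero_mk] at hp0 hp
        rw [affineCoordComplex_zero_mk, affineCoordComplex_one_mk, huv _ (div_ne_zero hp0 hp),
          inv_div]
    · exact if_neg hp0
  exact ⟨⟨F, continuous_of_eq_comp_affineCoordComplex hu hv h0 h1⟩, h0, h1⟩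

/-- **Range of the glued map** (registered stub `helper_gluedRange` of line `cross-cap-laurent`,
signature verbatim).  The glued map `F : ℂℙ¹ → X` of a two-chart pair `(u, v)` has range
`range u ∪ {v 0}`: a point `[w₀ : w₁]` with `w₀ ≠ 0` goes to `u (w₁ / w₀)`, the remaining point
`[0 : 1]` goes to `v 0`, and conversely `u z = F [1 : z]`, `v 0 = F [0 : 1]`.  (The compatibility
hypothesis is part of the registered signature but is not needed for this.) [folklore] -/
theorem helper_gluedRange : ∀ (X : Type) [TopologicalSpace X] (u v : ℂ → X) (F : C(ComplexProjectiveSpace 1, X)), (∀ z : ℂ, z ≠ 0 → v z = u z⁻¹) → (∀ p, CoordNeZero 0 p → F p = u (affineCoordComplex 0 p 0)) → (∀ p, CoordNeZero 1 p → F p = v (affineCoordComplex 1 p 0)) → Set.range F = Set.range u ∪ {v 0} := by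
  intro X _ u v F _ h0 h1
  apply Set.Subset.antisymm
  · rintro _ ⟨p, rfl⟩
    by_cases hp : CoordNeZero 0 p
    · exact Or.inl ⟨_, (h0 p hp).symm⟩
    · exact Or.inr (glued_apply_of_not_coordNeZero h1 hp)
  · rintro x (⟨z, rfl⟩ | hx)
    · exact ⟨_, glued_apply_pt_zero h0 z⟩
    · rw [Set.mem_singleton_iff.1 hx]
      exact ⟨_, glued_apply_pt_infty h1⟩

/-- **Uniqueness of the glued map** (registered stub `helper_gluedUnique` of line
`cross-cap-laurent`, signature verbatim).  Two continuous maps `F F' : ℂℙ¹ → X` that are both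
`u ∘ c₀` on the chart `{w₀ ≠ 0}` and `v ∘ c₁` on the chart `{w₁ ≠ 0}` coincide, since the two
affine charts cover `ℂℙ¹` (`exists_coordNeZero`). [folklore] -/
theorem helper_gluedUnique : ∀ (X : Type) [TopologicalSpace X] (u v : ℂ → X) (F F' : C(ComplexProjectiveSpace 1, X)), (∀ p, CoordNeZero 0 p → F p = u (affineCoordComplex 0 p 0)) → (∀ p, CoordNeZero 1 p → F p = v (affineCoordComplex 1 p 0)) → (∀ p, CoordNeZero 0 p → F' p = u (affineCoordComplex 0 p 0)) → (∀ p, CoordNeZero 1 p → F' p = v (affineCoordComplex 1 p 0)) → F = F' := by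
  intro X _ u v F F' h0 h1 h0' h1'
  ext p
  rcases Fin.exists_fin_two.1 (exists_coordNeZero p) with hp | hp
  · rw [h0 p hp, h0' p hp]
  · rw [h1 p hp, h1' p hp]

end Summit.SmoothPoincare4.SmoothPoincare4.Theorems.GromovRecognitionRelEnd.CrossCapLaurent

end
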